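import Literature.Probability.Percolation.PercolationEvents
import HarnessLib

/-!
# `NoHeavyLowerTail` (stmt-CriticalPhenomena-4575) — support file: reachability across a two-part edge decomposition
# (prover `prim-ineq-prove-2` gen 11; combinatorial half of the PARALLEL COMPOSITION LAW, THEOREM-SP.md §2 (PAR))

No definitions, no measure theory, no sorries.  Setting: two edge sets `E₁, E₂ ⊆ Sym2 V` whose edges have all their
vertices in `V₁`, `V₂` respectively, with `V₁ ∩ V₂ ⊆ S` (a vertex separator); open configurations `ω₁ ⊆ E₁`, `ω₂ ⊆ E₂`.

* `GZGluing.walk_split` — every open walk in `ω₁ ∪ ω₂` ending in `S` decomposes into a one-sided initial segment and a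
  chain of `S`-to-`S` hops each realised inside `ω₁` alone or inside `ω₂` alone;
* consequences for `S = {a, b, c}` (the two-terminal hub networks glued at the terminals `a, b` and the hub `c`):
  `notReach_hub_iff` (`{a ↮ c, b ↮ c}` factorises), `isolated_iff` (`{a ↮ b, a ↮ c}` factorises),
  `reach_off_iff` (`{a ↔ b off c}` is the union of the two one-sided events).
These are the set identities behind `z = z₁z₂`, `ā = ā₁ā₂`, `b̄ = b̄₁b̄₂`, `n = n₁n₂`, `1 − θ = (1−θ₁)(1−θ₂)` of the
parallel map (`GZParallel.parallel_cov_le_mul_log`).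
-/

namespace Summit.CriticalPhenomena.PercolationContinuityZ3.Theorems

open Literature.Probability.Percolation

namespace GZGluing

variable {V : Type*}

/-- A vertex from which a NON-trivial open walk of `ω ⊆ E` starts lies in the vertex set `W` carrying `E`. [folklore] -/
theorem mem_of_reachable_ne {E ω : Set (Sym2 V)} {W : Set V} (hE : ∀ e ∈ E, ∀ z ∈ e, z ∈ W) (hω : ω ⊆ E)
    {x s : V} (h : (openGraph ω).Reachable x s) (hxs : x ≠ s) : x ∈ W := by
  obtain ⟨p⟩ := h
  cases p with
  | nil => exact absurd rfl hxs
  | cons hadj _ =>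
    rw [openGraph_adj] at hadj
    exact hE _ (hω hadj.1) x (Sym2.mem_mk_left _ _)

/-- In a configuration with no edge at `c`, only `c` itself is joined to `c`. [folklore] -/
theorem eq_of_reachable_sdiff_hub {ω : Set (Sym2 V)} {c x : V}
    (h : (openGraph (ω \ {e : Sym2 V | c ∈ e})).Reachable c x) : x = c := by
  obtain ⟨p⟩ := h
  cases p with
  | nil => rfl
  | cons hadj _ =>
    rw [openGraph_adj] at hadj
    exact absurd (Sym2.mem_mk_left _ _) hadj.1.2

section split

variable {E₁ E₂ ω₁ ω₂ : Set (Sym2 V)} {V₁ V₂ S : Set V}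

/-- **Walk splitting at a vertex separator.**  If the edges of `E₁` live on `V₁`, those of `E₂` on `V₂`, and
`V₁ ∩ V₂ ⊆ S`, then for `ω₁ ⊆ E₁`, `ω₂ ⊆ E₂` every open walk of `ω₁ ∪ ω₂` from `x` to a vertex `y ∈ S` yields
`s ∈ S` joined to `x` inside ONE of `ω₁, ω₂` and a chain of `S`-to-`S` hops from `s` to `y`, each hop realised inside
`ω₁` alone or `ω₂` alone. [folklore] -/
theorem walk_split (h₁ : ∀ e ∈ E₁, ∀ z ∈ e, z ∈ V₁) (h₂ : ∀ e ∈ E₂, ∀ z ∈ e, z ∈ V₂) (hS : V₁ ∩ V₂ ⊆ S)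
    (hω₁ : ω₁ ⊆ E₁) (hω₂ : ω₂ ⊆ E₂) {x y : V} (p : (openGraph (ω₁ ∪ ω₂)).Walk x y) (hy : y ∈ S) :
    ∃ s, s ∈ S ∧ ((openGraph ω₁).Reachable x s ∨ (openGraph ω₂).Reachable x s) ∧
      Relation.ReflTransGen
        (fun u v => u ∈ S ∧ v ∈ S ∧ ((openGraph ω₁).Reachable u v ∨ (openGraph ω₂).Reachable u v)) s y := by
  induction p with
  | nil => exact ⟨_, hy, Or.inl (SimpleGraph.Reachable.refl _), Relation.ReflTransGen.refl⟩
  | @cons u v w hadj q ih =>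
    obtain ⟨s, hsS, hside, hchain⟩ := ih hy
    rw [openGraph_adj] at hadj
    obtain ⟨huv, hne⟩ := hadj
    -- the first edge lies in ω₁ or ω₂
    have hedge : ((openGraph ω₁).Adj u v) ∨ ((openGraph ω₂).Adj u v) := by
      rcases huv with h | h
      · exact Or.inl ((openGraph_adj ω₁ u v).2 ⟨h, hne⟩)
      · exact Or.inr ((openGraph_adj ω₂ u v).2 ⟨h, hne⟩)
    by_cases hvS : v ∈ S
    · -- split at v ∈ S
      refine ⟨v, hvS, ?_, ?_⟩
      · rcases hedge with h | h
        · exact Or.inl h.reachable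
        · exact Or.inr h.reachable
      · exact Relation.ReflTransGen.head ⟨hvS, hsS, hside⟩ hchain
    · -- v ∉ S: the edge and the one-sided segment from v lie on the same side
      have hvs : v ≠ s := fun h => hvS (h ▸ hsS)
      refine ⟨s, hsS, ?_, hchain⟩
      rcases hedge with he | he <;> rcases hside with hs | hs
      · exact Or.inl (he.reachable.trans hs)
      · -- edge in ω₁, segment in ω₂: v ∈ V₁ ∩ V₂ ⊆ S, contradiction
        have hv1 : v ∈ V₁ := h₁ _ (hω₁ ((openGraph_adj ω₁ u v).1 he).1) v (Sym2.mem_mk_right _ _)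
        have hv2 : v ∈ V₂ := mem_of_reachable_ne h₂ hω₂ hs hvs
        exact absurd (hS ⟨hv1, hv2⟩) hvS
      · have hv2 : v ∈ V₂ := h₂ _ (hω₂ ((openGraph_adj ω₂ u v).1 he).1) v (Sym2.mem_mk_right _ _)
        have hv1 : v ∈ V₁ := mem_of_reachable_ne h₁ hω₁ hs hvs
        exact absurd (hS ⟨hv1, hv2⟩) hvS
      · exact Or.inr (he.reachable.trans hs)

/-- Chains of hops stay inside any set closed under hops. [folklore] -/
theorem reflTransGen_mem {R : V → V → Prop} {A : Set V} (hA : ∀ u v, u ∈ A → R u v → v ∈ A)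
    {x y : V} (h : Relation.ReflTransGen R x y) (hx : x ∈ A) : y ∈ A := by
  induction h with
  | refl => exact hx
  | tail _ huv ih => exact hA _ _ ih huv

/-- One-sided reachability implies reachability in the union. [folklore] -/
theorem reachable_union_of_side {x y : V}
    (h : (openGraph ω₁).Reachable x y ∨ (openGraph ω₂).Reachable x y) :
    (openGraph (ω₁ ∪ ω₂)).Reachable x y := by
  rcases h with h | h
  · exact h.mono (openGraph_mono Set.subset_union_left)
  · exact h.mono (openGraph_mono Set.subset_union_right)

variable {a b c : V}

/-- **`{a ↮ c} ∩ {b ↮ c}` factorises** across the decomposition with separator `{a, b, c}`: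
`P(a ↮ c, b ↮ c)` is multiplicative under parallel composition. [folklore] -/
theorem notReach_hub_iff (h₁ : ∀ e ∈ E₁, ∀ z ∈ e, z ∈ V₁) (h₂ : ∀ e ∈ E₂, ∀ z ∈ e, z ∈ V₂)
    (hS : V₁ ∩ V₂ ⊆ {a, b, c}) (hω₁ : ω₁ ⊆ E₁) (hω₂ : ω₂ ⊆ E₂) (hac : a ≠ c) (hbc : b ≠ c) :
    (¬(openGraph (ω₁ ∪ ω₂)).Reachable a c ∧ ¬(openGraph (ω₁ ∪ ω₂)).Reachable b c) ↔
      ((¬(openGraph ω₁).Reachable a c ∧ ¬(openGraph ω₁).Reachable b c) ∧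
        (¬(openGraph ω₂).Reachable a c ∧ ¬(openGraph ω₂).Reachable b c)) := by
  constructor
  · rintro ⟨hac', hbc'⟩
    exact ⟨⟨fun h => hac' (reachable_union_of_side (Or.inl h)), fun h => hbc' (reachable_union_of_side (Or.inl h))⟩,
      ⟨fun h => hac' (reachable_union_of_side (Or.inr h)), fun h => hbc' (reachable_union_of_side (Or.inr h))⟩⟩
  · rintro ⟨⟨h1a, h1b⟩, ⟨h2a, h2b⟩⟩
    -- the set {a, b} is closed under hops
    have hA : ∀ u v, u ∈ ({a, b} : Set V) →
        (u ∈ ({a, b, c} : Set V) ∧ v ∈ ({a, b, c} : Set V) ∧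
          ((openGraph ω₁).Reachable u v ∨ (openGraph ω₂).Reachable u v)) → v ∈ ({a, b} : Set V) := by
      rintro u v hu ⟨-, hv, huv⟩
      rcases hv with rfl | rfl | rfl
      · exact Or.inl rfl
      · exact Or.inr rfl
      · exfalso
        rcases hu with rfl | rfl
        · rcases huv with h | h
          · exact h1a h
          · exact h2a h
        · rcases huv with h | h
          · exact h1b h
          · exact h2b h
    have key : ∀ x, x ∈ ({a, b} : Set V) → ¬(openGraph (ω₁ ∪ ω₂)).Reachable x c := by
      rintro x hx ⟨p⟩
      obtain ⟨s, hsS, hside, hchain⟩ := walk_split h₁ h₂ hS hω₁ hω₂ p (by simp)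
      have hs : s ∈ ({a, b} : Set V) := hA x s hx ⟨by rcases hx with rfl | rfl <;> simp, hsS, hside⟩
      have hc : c ∈ ({a, b} : Set V) := reflTransGen_mem hA hchain hs
      rcases hc with h | h
      · exact hac h.symm
      · exact hbc h.symm
    exact ⟨key a (Or.inl rfl), key b (Or.inr rfl)⟩

/-- **`{a isolated} = {a ↮ b} ∩ {a ↮ c}` factorises**: `P(a ↮ b, a ↮ c)` is multiplicative under parallel
composition (and symmetrically for `b`). [folklore] -/
theorem isolated_iff (h₁ : ∀ e ∈ E₁, ∀ z ∈ e, z ∈ V₁) (h₂ : ∀ e ∈ E₂, ∀ z ∈ e, z ∈ V₂)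
    (hS : V₁ ∩ V₂ ⊆ {a, b, c}) (hω₁ : ω₁ ⊆ E₁) (hω₂ : ω₂ ⊆ E₂) (hab : a ≠ b) (hac : a ≠ c) :
    (¬(openGraph (ω₁ ∪ ω₂)).Reachable a b ∧ ¬(openGraph (ω₁ ∪ ω₂)).Reachable a c) ↔
      ((¬(openGraph ω₁).Reachable a b ∧ ¬(openGraph ω₁).Reachable a c) ∧
        (¬(openGraph ω₂).Reachable a b ∧ ¬(openGraph ω₂).Reachable a c)) := by
  constructor
  · rintro ⟨hab', hac'⟩
    exact ⟨⟨fun h => hab' (reachable_union_of_side (Or.inl h)), fun h => hac' (reachable_union_of_side (Or.inl h))⟩,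
      ⟨fun h => hab' (reachable_union_of_side (Or.inr h)), fun h => hac' (reachable_union_of_side (Or.inr h))⟩⟩
  · rintro ⟨⟨h1b, h1c⟩, ⟨h2b, h2c⟩⟩
    have hA : ∀ u v, u ∈ ({a} : Set V) →
        (u ∈ ({a, b, c} : Set V) ∧ v ∈ ({a, b, c} : Set V) ∧
          ((openGraph ω₁).Reachable u v ∨ (openGraph ω₂).Reachable u v)) → v ∈ ({a} : Set V) := by
      rintro u v hu ⟨-, hv, huv⟩
      rw [Set.mem_singleton_iff] at hu
      subst hu
      rcases hv with rfl | rfl | rfl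
      · rfl
      · exfalso; rcases huv with h | h
        · exact h1b h
        · exact h2b h
      · exfalso; rcases huv with h | h
        · exact h1c h
        · exact h2c h
    have key : ∀ y, y ∈ ({a, b, c} : Set V) → (openGraph (ω₁ ∪ ω₂)).Reachable a y → y = a := by
      rintro y hy ⟨p⟩
      obtain ⟨s, hsS, hside, hchain⟩ := walk_split h₁ h₂ hS hω₁ hω₂ p hy
      have hs : s ∈ ({a} : Set V) := hA a s rfl ⟨by simp, hsS, hside⟩
      exact reflTransGen_mem hA hchain hs
    exact ⟨fun h => hab (key b (by simp) h).symm, fun h => hac (key c (by simp) h).symm⟩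

/-- **`{a ↔ b off c}` is the union of the one-sided events**: with the edges at `c` removed, `a` and `b` are joined
in `ω₁ ∪ ω₂` iff they are joined inside `ω₁` or inside `ω₂` (so `1 − θ` is multiplicative). [folklore] -/
theorem reach_off_iff (h₁ : ∀ e ∈ E₁, ∀ z ∈ e, z ∈ V₁) (h₂ : ∀ e ∈ E₂, ∀ z ∈ e, z ∈ V₂)
    (hS : V₁ ∩ V₂ ⊆ {a, b, c}) (hω₁ : ω₁ ⊆ E₁) (hω₂ : ω₂ ⊆ E₂) (hac : a ≠ c) :
    (openGraph ((ω₁ ∪ ω₂) \ {e : Sym2 V | c ∈ e})).Reachable a b ↔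
      ((openGraph (ω₁ \ {e : Sym2 V | c ∈ e})).Reachable a b ∨
        (openGraph (ω₂ \ {e : Sym2 V | c ∈ e})).Reachable a b) := by
  have hunion : (ω₁ ∪ ω₂) \ {e : Sym2 V | c ∈ e} = (ω₁ \ {e : Sym2 V | c ∈ e}) ∪ (ω₂ \ {e : Sym2 V | c ∈ e}) :=
    Set.union_sdiff_distrib
  rw [hunion]
  have hω₁' : ω₁ \ {e : Sym2 V | c ∈ e} ⊆ E₁ := Set.sdiff_subset.trans hω₁
  have hω₂' : ω₂ \ {e : Sym2 V | c ∈ e} ⊆ E₂ := Set.sdiff_subset.trans hω₂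
  constructor
  · rintro ⟨p⟩
    obtain ⟨s, hsS, hside, hchain⟩ := walk_split h₁ h₂ hS hω₁' hω₂' p (by simp)
    -- A := vertices reachable from a inside one side; closed under hops
    set A : Set V := {v | (openGraph (ω₁ \ {e : Sym2 V | c ∈ e})).Reachable a v ∨
      (openGraph (ω₂ \ {e : Sym2 V | c ∈ e})).Reachable a v} with hAdef
    have haA : a ∈ A := Or.inl (SimpleGraph.Reachable.refl _)
    have hcA : c ∉ A := by
      rintro (h | h)
      · exact hac (eq_of_reachable_sdiff_hub h.symm)
      · exact hac (eq_of_reachable_sdiff_hub h.symm)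
    have hA : ∀ u v, u ∈ A →
        (u ∈ ({a, b, c} : Set V) ∧ v ∈ ({a, b, c} : Set V) ∧
          ((openGraph (ω₁ \ {e : Sym2 V | c ∈ e})).Reachable u v ∨
            (openGraph (ω₂ \ {e : Sym2 V | c ∈ e})).Reachable u v)) → v ∈ A := by
      rintro u v hu ⟨huS, hv, huv⟩
      rcases hv with rfl | rfl | rfl
      · exact haA
      · rcases huS with rfl | rfl | rfl
        · exact huv
        · exact hu
        · exact absurd hu hcA
      · -- a hop into c is impossible off c (unless from c itself, which is not in A)
        rcases huS with rfl | rfl | rfl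
        · rcases huv with h | h
          · exact absurd (eq_of_reachable_sdiff_hub h.symm) hac
          · exact absurd (eq_of_reachable_sdiff_hub h.symm) hac
        · rcases huv with h | h
          · exact absurd hu (by rw [eq_of_reachable_sdiff_hub h.symm]; exact hcA)
          · exact absurd hu (by rw [eq_of_reachable_sdiff_hub h.symm]; exact hcA)
        · exact absurd hu hcA
    have hsA : s ∈ A := hA a s haA ⟨by simp, hsS, hside⟩
    exact reflTransGen_mem hA hchain hsA
  · rintro (h | h)
    · exact h.mono (openGraph_mono Set.subset_union_left)
    · exact h.mono (openGraph_mono Set.subset_union_right)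

end split

end GZGluing

end Summit.CriticalPhenomena.PercolationContinuityZ3.Theorems
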